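import Mathlib
import HarnessLib
import HarnessLib.Audit
import Summits.Langlands.Statement
import HarnessLib.Audit.Check
import HarnessLib.Audit.Status.Attr

/-!
Route: G2ShadowRankSeven

DORMANT since 2026-08-25T11:40:25Z (reconciler: no traction for 7.7 d (last activity item-evidence-added at 2026-08-17T19:13:18Z); parked, not closed — `ledger route dormant route-Langlands-G2ShadowRankSeven --off` to reactivate) — unstaffed, not closed; items shared with open routes are served there. `ledger route dormant <id> --off` reactivates.

# Route G2ShadowRankSeven — rank-7 irreducibility below its printed exception — the SL3 shadow
inside G2

NEAR-MISS HARVEST (lens 3.15; artefact DEFICIT.md). The irreducibility clause of direction (A) —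
"cuspidal ⇒ ρ_(π,ι) irreducible" — is printed for regular algebraic ESSENTIALLY SELF-DUAL cuspidal π
on GL_n up to n ≤ 6 cofinitely in λ (Hui, J. LMS 108 (2023)), and in 2025 moved twice: density one
for every n with 7 ∤ n, 4 ∤ n (Feng–Whitmore arXiv:2507.22631 Thm 1.1) and, over ℚ, n = 7 for all
but finitely many λ UNLESS some λ has Lie type G₂ (Dai arXiv:2510.12496 Thm 1.1). Both papers name
the same binding input: the SL₃-shadow Std ⊕ Std^∨ ⊕ 1 of the 7-dimensional representation of G₂
(same formal bi-character, non-polarisable summands; FW §1.3 "existing potential automorphy theorems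
seem to be insufficient"). It suffices to show X = RankSevenCofinite (v₀ = 6 → v₁ = 7): for every
regular L-algebraic cuspidal π on GL₇(𝔸_ℚ), essentially self-dual at Satake level, every compatible
ℓ-adic avatar is irreducible for all but finitely many ℓ. By Sen's theorem the Hodge–Tate
cocharacter lies in the algebraic monodromy group, so a G₂ (or 7A₁) type forces the seven
z-exponents to have the shape {c, c±p, c±q, c±(p+q)} ("G₂-admissible weight"); X is the conjunction
of C = GenericWeightCofinite (off that locus: Dai + Sen), B = LineOrIrreducibleAdmissible (on it:
irreducible or a one-dimensional subquotient — Dai's 7A₁/B₃ cells plus the 4+3 SO₄-shape killed by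
Goursat) and A = NoShadowLineAdmissible (on it: NO one-dimensional subquotient — the shadow itself,
the single input to improve). The rest of the summit is the declared residual RankSevenToLanglands.
No idea card exists for this sector.
Lean: `∀ (hcpt : Literature.NumberTheory.Automorphic.isCompact_glFiniteIntegralLevel 7 ℚ) (π :
Literature.NumberTheory.Automorphic.CuspidalAutomorphicRepData 7 ℚ hcpt) (T :
Literature.NumberTheory.Automorphic.InfinityType ℚ 7), π.1.HasInfinityType T → T.IsRegular →
T.IsLAlgebraic → (∃ (h1 : Literature.NumberTheory.Automorphic.isCompact_glFiniteIntegralLevel 1 ℚ)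
(η : Literature.NumberTheory.Automorphic.CuspidalAutomorphicRepData 1 ℚ h1), ∀ᶠ v :
IsDedekindDomain.HeightOneSpectrum (NumberField.RingOfIntegers ℚ) in Filter.cofinite, ∀ α : Multiset
ℂ, π.1.HasSatakeParamAt v α → ∃ e : ℂ, η.1.HasSatakeParamAt v {e} ∧ α.map (fun a => a⁻¹) = α.map
(fun a => e * a)) → ∃ S : Finset ℕ, ∀ (ℓ : ℕ) [Fact ℓ.Prime], ℓ ∉ S → ∀ (ι : PadicAlgCl ℓ ≃+* ℂ) (ρ
: Literature.NumberTheory.GaloisRepresentations.FramedGaloisRep ℚ (PadicAlgCl ℓ) 7), (∀ᶠ v :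
IsDedekindDomain.HeightOneSpectrum (NumberField.RingOfIntegers ℚ) in Filter.cofinite,
Summit.Langlands.SatakeFrobCompatibleAt ι π.1 ρ v) → ρ.toGaloisRep.IsIrreducible`

## Assembly
Pure logic. The Assembly item (A → B → C → J → Langlands) is PROVED outright in Sketch.lean
(`assembly_holds`, rc 0): the residual J applied to the target, assembled by `by_cases` on the
G₂-admissible weight shape — off the locus C gives irreducibility; on it B gives "irreducible ∨
one-dimensional subquotient" and A removes the subquotient (finite exceptional sets united). The
deciding theorem in glue.lean is `closes (hAsm : Assembly) (hA) (hB) (hC) (hJ) : Langlands := hAsm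
hA hB hC hJ`, so every declared item lies in its cone (BC6) and the first prover closes Assembly by
pasting `assembly_holds`.

Rationale: WHY THIS LINE. The printed chain (PT15 positive density → Xia's reduction to Lie-irreducible λ₀ →
classification of multiplicity-free irreducible types in dimension 7: 7A₁, G₂, B₃ → Serre–Hui
λ-independence of the formal BI-character → extend low-dimensional polarised type-A pieces to
compatible systems and raise the semisimple rank by Goursat) is insensitive to every input except
one: formal bi-characters see G₂ and its equal-rank subgroups SL₃, SO₄ as one object (Hui 2013,
doi:10.4310/MRL.2013.v20.n4.a8), and the SL₃-shadow's pieces σ (rank 3, Hodge–Tate weights {u, v,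
−u−v}, never consecutive) and σ^∨ are non-polarisable over ℚ, so CG13 / Hui / BLGGT / Qian have no
entry point (DEFICIT.md L7–L8, re-derived). New levers named for crux A, none used by any route of
this summit: (L-C, ranked first) ENDOSCOPY — SL₃ is the dual group of the elliptic endoscopic group
PGL₃ of G₂ and theta lifts from PGL₃ (Gan–Savin 2004) have exactly the shadow's Hodge–Tate shape, so
residual endoscopic descent (σ̄ automorphic on PGL₃: an Ash–Doud–Pollack Serre instance forced by
the G₂ Hecke algebra) followed by the ACC+ Fontaine–Laffaille automorphy LIFTING theorem over a CM
quadratic field (arXiv:1812.09999 Thm 6.1.2; no weight change needed, which is what FW's remark says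
is missing) puts σ in a compatible system and contradicts Lie-irreducibility at λ₀; (L-B)
eigenvariety reducibility loci (Bellaïche–Chenevier arXiv:math/0602340, anti-ordinary refinement on
the definite Sp(3) eigenvariety through π, Taïbi arXiv:1510.08395) converting the shadow into a
nonzero weight-0 Bloch–Kato class inside ad ρ, to be killed by an adjoint-Selmer vanishing theorem
WITHOUT enormous image (Newton–Thorne doi:10.4171/jems/1228 Thm 1 assumes enormous ⊃ irreducible —
exactly what fails); (L-A) non-polarised potential automorphy of σ over CM with weight change (Qian
arXiv:2104.09761 is ordinary-only). Imported areas: algebraic groups / λ-independence (Serre,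
Larsen–Pink, Hui), exceptional theta correspondences and endoscopy for G₂ (Gan–Savin, Chenevier
arXiv:1606.02991), Calegari–Geraghty-style lifting over CM (ACC+), eigenvarieties (B–C). Versus the
hub: the three irreducibility routes are n = 3 CM non-self-dual (IrreducibilityBySelfDuality), n = 4
CM non-self-dual (ExteriorSquareAscent) and prime rank NON-self-dual with an ordinary prime
(OrdinaryPrimeTransport, which excludes G₂ explicitly: "SL_p, Sym^(p−1), SO_p, G_2 — the last three
self-dual, excluded"); no route or card touches the polarised rank-7 cell or the exceptional group.

RANKED CRUXES. #0 RankSevenCofinite (target) — for every regular, L-algebraic cuspidal π on GL₇(𝔸_ℚ)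
essentially self-dual at Satake level (∃ Hecke character η with t_π⁻¹ = η·t_π a.e.), there is a
finite set S of primes such that for ℓ ∉ S, every ι : ℚ̄_ℓ ≃ ℂ and every framed ρ : Γ_ℚ → GL₇(ℚ̄_ℓ)
Satake–Frobenius compatible with (π, ι) at almost all places, ρ is irreducible (Dai 2025 Thm 1.1
with the G₂ exception deleted; Hui 2023's n ≤ 6 ↦ n = 7). (why it might fail: only through crux A: a
G₂-type π (they exist: Khare–Larsen–Savin arXiv:0807.0861, Dettweiler–Reiter
doi:10.1112/s0010437x10004641) whose avatars carry the SL₃-shadow at infinitely many λ would refute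
it and the irreducibility conjecture (Ramakrishnan math/0609460) at once.) [arXiv:2510.12496,
arXiv:2507.22631, doi:10.1112/jlms.12811, arXiv:math/0609460, BuzzardGeeLMS2014]
#2 NoShadowLineAdmissible (crux) — (the binding input I at v₁ = 7) for π as in the target whose
infinity type is G₂-ADMISSIBLE (z-exponents {c, c±p, c±q, c±(p+q)} at the embedding ℚ → ℂ):
cofinitely in ℓ, no compatible framed avatar ρ has a one-dimensional subquotient (excludes the
SL₃-shadow σ ⊕ σ^∨ ⊕ χ, χ² = multiplier, and its induced form Ind(σ) ⊕ χ; robust to non-semisimple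
avatars). [difficulty: open-problem] (why it might fail: the shadow has G₂'s formal bi-character and
non-polarisable rank-3 pieces of non-consecutive weight (FW25 §1.3): every printed tool is blind;
L-C needs residual automorphy of σ̄ on PGL₃ (an open Serre-type instance), L-B an adjoint-Selmer
theorem without enormous image.) [arXiv:2507.22631, arXiv:2510.12496, arXiv:1812.09999,
doi:10.4171/jems/1228, arXiv:math/0602340, doi:10.1112/S0010437X03000629, arXiv:1606.02991,
doi:10.4310/MRL.2013.v20.n4.a8]
#3 LineOrIrreducibleAdmissible (crux) — for π as in crux A (G₂-admissible weight): cofinitely in ℓ,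
every compatible framed avatar is irreducible OR has a one-dimensional subquotient — Dai's printed
7A₁ and B₃ cells re-run in admissible weight, plus the one G₂ shape they leave besides the shadow, 4
+ 3 (SO₄ ⊂ G₂): its 3 is odd essentially self-dual of type SO₃ (Calegari–Gee Cor.), fits a
compatible system (Hui BLMS 2023), and Goursat on G₂ × SO₃ (G₂ has no A₁ quotient) raises the
semisimple rank at a Lie-irreducible λ₀, contradicting Serre–Hui λ-independence. [difficulty: L]
(why it might fail: rests on Dai's unrefereed Oct-2025 argument over ℚ (Prop 2.17 = the preprint
Da25) and on Hui's algebraic envelopes for cofinite residual irreducibility of type-A pieces; a gap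
there, or a reducible shape I missed for rank-2 derived groups, reopens it.) [arXiv:2510.12496,
arXiv:2503.04541, doi:10.1112/jlms.12811, arXiv:1104.4827, arXiv:1307.1640,
doi:10.4007/annals.2014.179.2.3]
#4 GenericWeightCofinite (crux) — for π as in the target whose infinity type is NOT G₂-admissible:
cofinite irreducibility — Dai 2025 Thm 1.1 made unconditional by Sen's theorem (the Sen operator
lies in the Lie algebra of the image, doi:10.2307/1970879, so a G₂ or 7A₁ Lie type forces the
admissible shape and only the B₃ / induced types remain, Dai §3, §4.2). [difficulty: M] (why it
might fail: F = ℚ only and Dai's B₃ cell uses BLGGT potential automorphy of an SO₆ piece with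
residual irreducibility over ℚ(ζ_ℓ) supplied cofinitely by Hui 2023 — if that supply needs connected
monodromy over ℚ itself the cofinite set may depend on more than π.) [arXiv:2510.12496,
doi:10.2307/1970879, doi:10.1112/jlms.12811, doi:10.4007/annals.2014.179.2.3, arXiv:1307.1640]
#9 RankSevenToLanglands (support) — the honest rest of the summit along this line (RESIDUAL; not
attacked): Langlands given cofinite rank-7 polarised irreducibility over ℚ — the finitely many
exceptional ℓ, all other n, fields, non-polarised and irregular π, local–global compatibility, and
direction (B). [difficulty: open-problem] [BuzzardGeeLMS2014, arXiv:math/0609460]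

TWO-LAYER PLAN. Foreseen glued splits (k ≤ 3, depth 1), typed and kernel-checked in bc/*_birth.lean:
A ⇐ SemisimpleCompanionLine (semisimplification keeps Satake compatibility; a 1-dim constituent
becomes a stable line) → NoStableLineSemisimple (the heart) → A; B ⇐ SemisimpleCompanionTransport →
LineOrIrreducibleOrFourThree (Dai's cells) → NoFourThreeSplit (Goursat) → B; C ⇐
SemisimpleCompanionIrreducible → GenericShapes (Sen + B₃ formal character) → GenericNoLine /
GenericNoSmallPiece (Dai §4.2 (i)/(ii)) → C. Inside NoStableLineSemisimple a tenure planner files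
the L-C chain: ResidualEndoscopicDescentG2 (σ̄ ⊕ σ̄^∨ ⊕ 1 automorphic on G₂ ⇒ σ̄ automorphic on
PGL₃) → ShadowLiftingCM (ACC+ 6.1.2 over a CM quadratic field in the shadow weight) →
NoStableLineSemisimple.

KILL CRITERIA. (K1) A refuter exhibits a regular ess. self-dual cuspidal π on GL₇/ℚ of G₂-admissible
weight and a PROOF that its avatars have a one-dimensional subquotient at infinitely many ℓ: refutes
A, the target and the irreducibility conjecture — close `refuted:NoShadowLineAdmissible`, file the
witness under Theorems/…/Negative. (K2) The hypergeometric/Dettweiler–Reiter census (Cheapest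
falsifier) finds a λ passing the residual shadow pattern at all p ≤ 300: not a refutation (residual
≠ λ-adic) but A is re-ranked and the L-C lever gets that (π, λ) as its first test. (K3) A printed
sequel (Dai/Hui/Feng–Whitmore) closes the G₂ cell: A becomes `known` — superseded for staffing, the
route still decides its sector. (K4) If B or C turns out to need the shadow exclusion (i.e. my claim
that Dai's cells + Goursat give "irreducible ∨ line" is wrong), the typing is wrong — restate B with
the missing shape as a third disjunct and file its exclusion.

NOT DECOMPOSED YET. The interior of A (the L-C chain: mod-ℓ exceptional theta / endoscopic
congruences on compact G₂, the ADPS-Serre instance, the FL lifting over a CM quadratic field with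
Miagkov–Thorne adequacy; or the L-B chain: generic irreducibility of the Sp(3)-eigenvariety
pseudocharacter at an anti-ordinary refinement, adjoint Selmer without enormous image); the
vendoring of Dai Thm 1.1, Hui 2023 Thm 1.2/2.15, CG13 Cor., BLGGT Thm C, PT15, Sen 1973 as named
Literature facts (first-prover duty); the semisimplification lemma for framed ℓ-adic representations
(stub, M); F totally real ≠ ℚ and n = 7m (Feng–Whitmore's 7 ∣ n) — ascents a tenure planner may add;
the n = 8 Spin₇-AP cell (a sibling near-miss, different shadow (SL₄, Std ⊕ Std^∨)).

CHEAPEST FALSIFIER. One kit job (pari `hgminit`/`hgmeulerfactor`, or sage): take a rank-7 compatible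
system of ℚ with monodromy G₂ and 7 distinct Hodge–Tate weights — a Dettweiler–Reiter motive M_s
(doi:10.1112/s0010437x10004641, s ∈ ℚ ∖ {0,1}) or one of Katz's G₂ hypergeometrics — compute P_p(T)
for p ≤ 300, and for each prime λ ≤ 60 test whether P_p ≡ (T − u)·g(T)·g̃(T) mod λ for ALL p with u²
= multiplier, g cubic and g̃ its dual-reciprocal (the residual SL₃-shadow pattern). Expected: every
λ fails at some p (certifying "no shadow at λ" for that motive — a decidable instance of A's
residual strengthening); a λ that passes everywhere is a candidate shadow prime and becomes the L-C
lever's first test case. Not run this session (the G₂ hypergeometric parameters must first be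
transcribed from Katz ESDE / Dettweiler–Reiter Thm 1). Literature kill already run (2026-08-17):
arXiv/zbMATH/galaxy searches for the G₂ cell (§ Novelty) found no treatment; Feng–Whitmore §1.3 and
Dai Thm 1.1 (both 2025) state it as excluded.

NUMBERS. Printed thresholds: n ≤ 5 cofinite (CG13, arXiv:1104.4827), n ≤ 6 cofinite over TR/CM (Hui
2023, doi:10.1112/jlms.12811), positive density any n (PT15, arXiv:1307.1640), density one for 7 ∤ n
∧ 4 ∤ n (FW25 Thm 1.1), n = 7 over ℚ cofinite minus Lie type G₂ and n = 8 minus Spin₇ with a 3-term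
AP of HT weights (Dai Thm 1.1), all λ for A₁-type (Hui–Lee 2024/25), BLGGT potential automorphy ℓ ≥
2(n+1) = 16 in FL range (Dai Thm 2.10/Lemma 2.11). This route: v₀ = 6 → v₁ = 7; the G₂-admissible
weight locus d₃ = d₁ + d₂ is codimension one in the 3-parameter family of regular self-dual weights
of GL₇/ℚ; the shadow's rank-3 piece has weights {u, v, −u−v}, never consecutive. Items at open: 6
(target, 3 cruxes, residual support, assembly — all in the cone of `closes`, BC6).

DEFINITION REQUESTS. None: CuspidalAutomorphicRepData, InfinityType, ArchWeight.a, HasInfinityType,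
IsRegular, IsLAlgebraic, HasSatakeParamAt, isCompact_glFiniteIntegralLevel, FramedGaloisRep,
toGaloisRep, ContinuousRep.IsIrreducible / IsSemisimple, Mathlib Subrepresentation,
Summit.Langlands.SatakeFrobCompatibleAt all exist (lean search --decl; Sketch.lean rc 0). A prover
will want `FramedRep.semisimplification` (framed ℓ-adic semisimplification with equal charpolys) as
a Literature definition+lemma and the named facts Dai2025 Thm 1.1, Hui2023 Thm 1.2 / Prop 2.12 / Thm
2.15, CalegariGee2013 Cor. 2.14-shape, BLGGT2014 Thm C, PatrikisTaylor2015, Sen1973 Thm 1 (not filed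
now, D-0027 §3.3).

Novelty: Searches (2026-08-17; OpenAlex/S2 429 all day, local searchd + zbMATH + arXiv + crossref + galaxy
live): `lit search "irreducibility automorphic Galois representations low dimension regular
algebraic essentially self-dual" -n 25` (local 1: arXiv:2510.12496 READ in full; crossref 23 incl.
Xia 2018, Hui 2023); `lit search "G2 compatible system Galois representations irreducibility
lambda-independence exceptional group seven-dimensional"` (local 2: arXiv:2503.04541, 2510.12496;
crossref: BCELMP FMS 2019 (E₆), Patrikis–Snowden–Wiles 2016); `lit search "Feng Whitmore
irreducibility polarized …"` (→ arXiv:2507.22631 READ pp.1–6 incl. §1.3); `lit search --source arxiv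
"irreducibility Galois representations GL(7) G2 automorphic"` (0), `--source zbmath "irreducibility
automorphic Galois representations G2"` (0), `--source arxiv "compatible systems G2 monodromy
irreducible"` (0), `--source zbmath "Galois representations exceptional group G2 compatible system"`
(0); `lit galaxy search "Galois representations of type G2" --star all` (0), `"monodromy group G2"
--star all` (0); `lit search --hybrid "Newton Thorne adjoint Selmer …"` (→ arXiv:1912.11265 READ
pp.1–4: Thm 1 needs enormous image); reads: arXiv:2607.11763 pp.1–8 (ACHTW: Thm 1.2.1, Rem 1.3),
arXiv:2404.08954 pp.1–3 (Böckle–Hui: the homothety character of odd GO_n is always a WEAK abelian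
summand — their tool cannot see the shadow line), arXiv:math/0605382 pp.1–4 (Dettweiler–Reiter G₂),
the 92 Langlands Theses headers (full read o  [refs: 2510.12496, 2503.04541, 2507.22631, 1912.11265, 2607.11763, 2404.08954, math/0605382]

Barriers (technique_class: lambda-independence, pot-automorphy, G2-endoscopy): - technique_class: lambda-independence, pot-automorphy, G2-endoscopy
- Literature.Barriers.Langlands.ResiduallyReducibleBarrier: APPLIES head-on to crux A — at a shadow
prime ρ̄_π = 1 ⊕ σ̄ ⊕ σ̄^∨ is residually (indeed λ-adically) reducible, so Taylor–Wiles on π itself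
(lever L-B's adjoint Selmer; Newton–Thorne's enormous hypothesis) is inside the class; EVADED by
L-C, which runs the lifting theorem on the PIECE σ|_CM whose residual image is enormous in GL₃ for λ
≫ 0 (Hui 2023 Thm 2.15(iv): type-A summands are residually irreducible cofinitely) and uses the
reducibility of ρ̄_π as a RESOURCE (it is the endoscopic congruence); for B and C the BLGGT step
needs residual irreducibility of the polarised type-A piece over ℚ(ζ_ℓ), discharged cofinitely by
Hui's algebraic envelopes exactly as in Dai/Hui.
- Literature.Barriers.Langlands.TwistedEndoscopySelfDual: APPLIES to the shadow piece σ (rank 3, NOT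
essentially self-dual over ℚ: no Galois-to-automorphic transfer over a totally real field); evaded
by base change to a CM quadratic field M, where HLTT/Scholze/ACC+ treat non-polarised GL₃ (the
barrier's own scope caveat), and by G₂ ⊂ SO₇ for π itself (θ-stable).
- Literature.Barriers.Langlands.ShimuraVarietyRealizationBarrier: σ over ℚ reaches no Shimura
variety (n = 3, not self-dual); same evasion (CM base change, torsion classes of ACC+); π itself is
polarised regular over ℚ — inside the known realisation.
- Literature.Barriers.Langlands.PatchingLocalComponentBarrier: the FL lifting

History (route lifecycle, newest last):
- 2026-08-25T11:40:25Z · DORMANT — reconciler: no traction for 7.7 d (last activity item-evidence-added at 2026-08-17T19:13:18Z); parked, not closed — `ledger route dormant route-Langlands-G2Shad (operator:999:801842)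

sub-problem: Langlands · status: dormant · opened planner-plan-lens3-Langlands-nearmiss-g3-0 2026-08-17T14:48:11Z · rev 1 · ledger route-Langlands-G2ShadowRankSeven
GENERATED by the gate from the ledger (D-0016/17). Provers cite these decls: `theorem foo : Summit.Langlands.Langlands.Theses.G2ShadowRankSeven.<Decl> := …` in Summits/Langlands/Langlands/Theorems/<Name>.lean.
-/

namespace Summit.Langlands.Langlands.Theses.G2ShadowRankSeven

open scoped BigOperators Topology Manifold Classical MeasureTheory ProbabilityTheory Matrix InnerProductSpace ComplexConjugate ContinuousMap
open Filter Set Function TopologicalSpace MeasureTheory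

attribute [summit_statement] _root_.Langlands

/-- item stmt-Langlands-18287 · target · rank 0 · open · by planner
why it might fail: only through crux A: a G₂-type π (they exist: Khare–Larsen–Savin arXiv:0807.0861, Dettweiler–Reiter doi:10.1112/s0010437x10004641) whose avatars carry the SL₃-shadow at infinitely many λ would refute it and the irreducibility conjecture (Ramakrishnan math/0609460) at once.
sources: arXiv:2510.12496, arXiv:2507.22631, doi:10.1112/jlms.12811, arXiv:math/0609460, BuzzardGeeLMS2014
[target] for every regular, L-algebraic cuspidal π on GL₇(𝔸_ℚ) essentially self-dual at Satake level
(∃ Hecke character η with t_π⁻¹ = η·t_π a.e.), there is a finite set S of primes such that for ℓ ∉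
S, every ι : ℚ̄_ℓ ≃ ℂ and every framed ρ : Γ_ℚ → GL₇(ℚ̄_ℓ) Satake–Frobenius compatible with (π, ι)
at almost all places, ρ is irreducible (Dai 2025 Thm 1.1 with the G₂ exception deleted; Hui 2023's n
≤ 6 ↦ n = 7). -/
@[route_item "route-Langlands-G2ShadowRankSeven"]
def RankSevenCofinite : Prop :=
  ∀ (hcpt : Literature.NumberTheory.Automorphic.isCompact_glFiniteIntegralLevel 7 ℚ) (π : Literature.NumberTheory.Automorphic.CuspidalAutomorphicRepData 7 ℚ hcpt) (T : Literature.NumberTheory.Automorphic.InfinityType ℚ 7), π.1.HasInfinityType T → T.IsRegular → T.IsLAlgebraic → (∃ (h1 : Literature.NumberTheory.Automorphic.isCompact_glFiniteIntegralLevel 1 ℚ) (η : Literature.NumberTheory.Automorphic.CuspidalAutomorphicRepData 1 ℚ h1), ∀ᶠ v : IsDedekindDomain.HeightOneSpectrum (NumberField.RingOfIntegers ℚ) in Filter.cofinite, ∀ α : Multiset ℂ, π.1.HasSatakeParamAt v α → ∃ e : ℂ, η.1.HasSatakeParamAt v {e} ∧ α.map (fun a => a⁻¹) = α.map (fun a =>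 e * a)) → ∃ S : Finset ℕ, ∀ (ℓ : ℕ) [Fact ℓ.Prime], ℓ ∉ S → ∀ (ι : PadicAlgCl ℓ ≃+* ℂ) (ρ : Literature.NumberTheory.GaloisRepresentations.FramedGaloisRep ℚ (PadicAlgCl ℓ) 7), (∀ᶠ v : IsDedekindDomain.HeightOneSpectrum (NumberField.RingOfIntegers ℚ) in Filter.cofinite, Summit.Langlands.SatakeFrobCompatibleAt ι π.1 ρ v) → ρ.toGaloisRep.IsIrreducible

/-- item stmt-Langlands-18288 · crux · rank 2 · open · by planner
why it might fail: the shadow has G₂'s formal bi-character and non-polarisable rank-3 pieces of non-consecutive weight (FW25 §1.3): every printed tool is blind; L-C needs residual automorphy of σ̄ on PGL₃ (an open Serre-type instance), L-B an adjoint-Selmer theorem without enormous image.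
sources: arXiv:2507.22631, arXiv:2510.12496, arXiv:1812.09999, doi:10.4171/jems/1228, arXiv:math/0602340, doi:10.1112/S0010437X03000629
[crux] (the binding input I at v₁ = 7) for π as in the target whose infinity type is G₂-ADMISSIBLE
(z-exponents {c, c±p, c±q, c±(p+q)} at the embedding ℚ → ℂ): cofinitely in ℓ, no compatible framed
avatar ρ has a one-dimensional subquotient (excludes the SL₃-shadow σ ⊕ σ^∨ ⊕ χ, χ² = multiplier,
and its induced form Ind(σ) ⊕ χ; robust to non-semisimple avatars). [difficulty: open-problem] -/
@[route_item "route-Langlands-G2ShadowRankSeven", crux]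
def NoShadowLineAdmissible : Prop :=
  ∀ (hcpt : Literature.NumberTheory.Automorphic.isCompact_glFiniteIntegralLevel 7 ℚ) (π : Literature.NumberTheory.Automorphic.CuspidalAutomorphicRepData 7 ℚ hcpt) (T : Literature.NumberTheory.Automorphic.InfinityType ℚ 7), π.1.HasInfinityType T → T.IsRegular → T.IsLAlgebraic → (∃ (h1 : Literature.NumberTheory.Automorphic.isCompact_glFiniteIntegralLevel 1 ℚ) (η : Literature.NumberTheory.Automorphic.CuspidalAutomorphicRepData 1 ℚ h1), ∀ᶠ v : IsDedekindDomain.HeightOneSpectrum (NumberField.RingOfIntegers ℚ) in Filter.cofinite, ∀ α : Multiset ℂ, π.1.HasSatakeParamAt v α → ∃ e : ℂ, η.1.HasSatakeParamAt v {e} ∧ α.map (fun a => a⁻¹) = α.map (fun a => e * a)) → (∀ σ : ℚ →+* ℂ, ∃ c p q : ℂ, (T σ).map Literature.NumberTheory.Automorphic.ArchWeight.a = {c, c + p, c - p, c + q, c - q, c + (p + q), c - (p + q)}) → ∃ S : Finset ℕ, ∀ (ℓ : ℕ) [Fact ℓ.Prime], ℓ ∉ S → ∀ (ι : PadicAlgCl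 ℓ ≃+* ℂ) (ρ : Literature.NumberTheory.GaloisRepresentations.FramedGaloisRep ℚ (PadicAlgCl ℓ) 7), (∀ᶠ v : IsDedekindDomain.HeightOneSpectrum (NumberField.RingOfIntegers ℚ) in Filter.cofinite, Summit.Langlands.SatakeFrobCompatibleAt ι π.1 ρ v) → ¬ (∃ W W' : Subrepresentation ρ.toGaloisRep.toRepresentation, W' < W ∧ Module.finrank (PadicAlgCl ℓ) W.toSubmodule = Module.finrank (PadicAlgCl ℓ) W'.toSubmodule + 1)

/-- item stmt-Langlands-18289 · crux · rank 3 · open · by planner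
why it might fail: rests on Dai's unrefereed Oct-2025 argument over ℚ (Prop 2.17 = the preprint Da25) and on Hui's algebraic envelopes for cofinite residual irreducibility of type-A pieces; a gap there, or a reducible shape I missed for rank-2 derived groups, reopens it.
sources: arXiv:2510.12496, arXiv:2503.04541, doi:10.1112/jlms.12811, arXiv:1104.4827, arXiv:1307.1640, doi:10.4007/annals.2014.179.2.3
[crux] for π as in crux A (G₂-admissible weight): cofinitely in ℓ, every compatible framed avatar is
irreducible OR has a one-dimensional subquotient — Dai's printed 7A₁ and B₃ cells re-run in
admissible weight, plus the one G₂ shape they leave besides the shadow, 4 + 3 (SO₄ ⊂ G₂): its 3 is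
odd essentially self-dual of type SO₃ (Calegari–Gee Cor.), fits a compatible system (Hui BLMS 2023),
and Goursat on G₂ × SO₃ (G₂ has no A₁ quotient) raises the semisimple rank at a Lie-irreducible λ₀,
contradicting Serre–Hui λ-independence. [difficulty: L] -/
@[route_item "route-Langlands-G2ShadowRankSeven", crux]
def LineOrIrreducibleAdmissible : Prop :=
  ∀ (hcpt : Literature.NumberTheory.Automorphic.isCompact_glFiniteIntegralLevel 7 ℚ) (π : Literature.NumberTheory.Automorphic.CuspidalAutomorphicRepData 7 ℚ hcpt) (T : Literature.NumberTheory.Automorphic.InfinityType ℚ 7), π.1.HasInfinityType T → T.IsRegular → T.IsLAlgebraic → (∃ (h1 : Literature.NumberTheory.Automorphic.isCompact_glFiniteIntegralLevel 1 ℚ) (η : Literature.NumberTheory.Automorphic.CuspidalAutomorphicRepData 1 ℚ h1), ∀ᶠ v : IsDedekindDomain.HeightOneSpectrum (NumberField.RingOfIntegers ℚ) in Filter.cofinite, ∀ α : Multiset ℂ, π.1.HasSatakeParamAt v α → ∃ e : ℂ, η.1.HasSatakeParamAt v {e} ∧ α.map (fun a => a⁻¹) = α.map (fun a => e * a)) →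 (∀ σ : ℚ →+* ℂ, ∃ c p q : ℂ, (T σ).map Literature.NumberTheory.Automorphic.ArchWeight.a = {c, c + p, c - p, c + q, c - q, c + (p + q), c - (p + q)}) → ∃ S : Finset ℕ, ∀ (ℓ : ℕ) [Fact ℓ.Prime], ℓ ∉ S → ∀ (ι : PadicAlgCl ℓ ≃+* ℂ) (ρ : Literature.NumberTheory.GaloisRepresentations.FramedGaloisRep ℚ (PadicAlgCl ℓ) 7), (∀ᶠ v : IsDedekindDomain.HeightOneSpectrum (NumberField.RingOfIntegers ℚ) in Filter.cofinite, Summit.Langlands.SatakeFrobCompatibleAt ι π.1 ρ v) → ρ.toGaloisRep.IsIrreducible ∨ (∃ W W' : Subrepresentation ρ.toGaloisRep.toRepresentation, W' < W ∧ Module.finrank (PadicAlgCl ℓ) W.toSubmodule = Module.finrank (PadicAlgCl ℓ) W'.toSubmodule + 1)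

/-- item stmt-Langlands-18290 · crux · rank 4 · open · by planner
why it might fail: F = ℚ only and Dai's B₃ cell uses BLGGT potential automorphy of an SO₆ piece with residual irreducibility over ℚ(ζ_ℓ) supplied cofinitely by Hui 2023 — if that supply needs connected monodromy over ℚ itself the cofinite set may depend on more than π.
sources: arXiv:2510.12496, doi:10.2307/1970879, doi:10.1112/jlms.12811, doi:10.4007/annals.2014.179.2.3, arXiv:1307.1640
[crux] for π as in the target whose infinity type is NOT G₂-admissible: cofinite irreducibility —
Dai 2025 Thm 1.1 made unconditional by Sen's theorem (the Sen operator lies in the Lie algebra of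
the image, doi:10.2307/1970879, so a G₂ or 7A₁ Lie type forces the admissible shape and only the B₃
/ induced types remain, Dai §3, §4.2). [difficulty: M] -/
@[route_item "route-Langlands-G2ShadowRankSeven", crux]
def GenericWeightCofinite : Prop :=
  ∀ (hcpt : Literature.NumberTheory.Automorphic.isCompact_glFiniteIntegralLevel 7 ℚ) (π : Literature.NumberTheory.Automorphic.CuspidalAutomorphicRepData 7 ℚ hcpt) (T : Literature.NumberTheory.Automorphic.InfinityType ℚ 7), π.1.HasInfinityType T → T.IsRegular → T.IsLAlgebraic → (∃ (h1 : Literature.NumberTheory.Automorphic.isCompact_glFiniteIntegralLevel 1 ℚ) (η : Literature.NumberTheory.Automorphic.CuspidalAutomorphicRepData 1 ℚ h1), ∀ᶠ v : IsDedekindDomain.HeightOneSpectrum (NumberField.RingOfIntegers ℚ) in Filter.cofinite, ∀ α : Multiset ℂ, π.1.HasSatakeParamAt v α → ∃ e : ℂ, η.1.HasSatakeParamAt v {e} ∧ α.map (fun a => a⁻¹) = α.map (fun a => e * a)) → (¬ ∀ σ : ℚ →+* ℂ, ∃ c p q : ℂ, (T σ).map Literature.NumberTheory.Automorphic.ArchWeight.a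 = {c, c + p, c - p, c + q, c - q, c + (p + q), c - (p + q)}) → ∃ S : Finset ℕ, ∀ (ℓ : ℕ) [Fact ℓ.Prime], ℓ ∉ S → ∀ (ι : PadicAlgCl ℓ ≃+* ℂ) (ρ : Literature.NumberTheory.GaloisRepresentations.FramedGaloisRep ℚ (PadicAlgCl ℓ) 7), (∀ᶠ v : IsDedekindDomain.HeightOneSpectrum (NumberField.RingOfIntegers ℚ) in Filter.cofinite, Summit.Langlands.SatakeFrobCompatibleAt ι π.1 ρ v) → ρ.toGaloisRep.IsIrreducible

/-- item stmt-Langlands-18291 · support · rank 9 · open · by planner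
sources: BuzzardGeeLMS2014, arXiv:math/0609460
[support] the honest rest of the summit along this line (RESIDUAL; not attacked): Langlands given
cofinite rank-7 polarised irreducibility over ℚ — the finitely many exceptional ℓ, all other n,
fields, non-polarised and irregular π, local–global compatibility, and direction (B). [difficulty:
open-problem] -/
@[route_item "route-Langlands-G2ShadowRankSeven", crux]
def RankSevenToLanglands : Prop :=
  RankSevenCofinite → Langlands

/-- item stmt-Langlands-18292 · assembly · rank 1 · closed · proved by Summit.Langlands.Langlands.Theorems.G2ShadowRankSeven.Assembly_proof @ 600a6c26eaca (prover) · by planner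
sources: arXiv:2510.12496, BuzzardGeeLMS2014
[assembly] NoShadowLineAdmissible → LineOrIrreducibleAdmissible → GenericWeightCofinite →
RankSevenToLanglands → Langlands (the route's standing claim "the three cells and the residual
suffice"; proved outright in Sketch.lean by the weight dichotomy, and consumed by `closes`). -/
@[route_item "route-Langlands-G2ShadowRankSeven", crux]
def Assembly : Prop :=
  NoShadowLineAdmissible → LineOrIrreducibleAdmissible → GenericWeightCofinite → RankSevenToLanglands → Langlands

/-! D-0027 §2.1 — DECIDING THEOREM (planner-authored via `route open/edit --closes-file`; by planner-plan-lens3-Langlands-nearmiss-g3-0 2026-08-17T14:48:11Z):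
its hypotheses are this route's items and its conclusion the sub-problem Statement (glue_lint), and it elaborates with this file. -/

@[closes "route-Langlands-G2ShadowRankSeven"] theorem closes (hAsm : Assembly) (hA : NoShadowLineAdmissible) (hB : LineOrIrreducibleAdmissible)
    (hC : GenericWeightCofinite) (hJ : RankSevenToLanglands) : Langlands :=
  hAsm hA hB hC hJ

end Summit.Langlands.Langlands.Theses.G2ShadowRankSeven
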